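import Summits.BirchSwinnertonDyer.BirchSwinnertonDyer.Theorems.PrintCf2RubinValueTwoEllipticUnitsLocalRelation
import Literature.NumberTheory.EllipticCurves.PAdicOneVariableSeriesFamilyMomentsOfCharacter
import Literature.NumberTheory.NumberFields.RayClassFieldAdicCharacterDivision
import HarnessLib

/-!
# de Shalit II.4.12 at ONE `𝔓`-component for the ELLIPTIC UNITS: the integral measure `μ_𝔓(𝔪)` on `Gal(K̄/K(𝔪))` along the ray
# class tower `K(𝔪v^{n+1})` with `δ_{σ_𝔠, N𝔠} μ = i(e(𝔠))` for every twist `𝔠` EXISTS (brick B5 assembled into the measure side)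

Cell `bsd-print-cf2`, width seat `bsd-line-cf2c-w4` g10 (brick `stub_measureExists` = the measure side of de Shalit II.4 at `p = 2`);
`--supports` the banked S3a item stmt-BirchSwinnertonDyer-24721 (helper, Theses-free). THEOREMS ONLY; CONDITIONAL on the published named
facts `DeShalit1987.prop24_ii_galoisAction`, `prop24_iii_unit`, `prop25_i_normRelation` (hypotheses, never asserted).

PRINT (de Shalit II.4.12, p. 66–69): for the elliptic units `β(𝔠) = (Θ(1; 𝔣𝔭^{n+1}, 𝔠))_n ∈ 𝒰` and the `𝐃`-valued measures
`μ_𝔠 := i(β(𝔠))` on `𝒢 = Gal(K(𝔣𝔭^∞)/K)` there is a unique measure `μ(𝔣)` with `μ_𝔠 = (σ_𝔠 − N𝔠)μ(𝔣)` for all `𝔠` (division by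
`σ_{𝔞₁} − N𝔞₁` for an auxiliary `𝔞₁` with `σ_{𝔞₁}` topologically generating `Gal(K(𝔣𝔭^∞)/K(𝔣𝔭^s))`, and II.2.4 (ii) to make the quotient
independent of `𝔞₁`).  The tree's β-agnostic package `exists_twisting_μ_eq_forall_seriesFamily` (cf2c-w4 g7, p728641) proves exactly this
along an abstract tower for an abstract `[κ]`-equivariant series family; cf2c-w4 g8 built the GLOBAL tower `rayAdicTower` of
`G = Gal(K̄/K(𝔪))` with its character `κ_v` and the division data of Artin symbols; cf2c-w4 g9 made the `𝔓`-adic units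
`𝒰_𝔓 = RelNormCoherentUnits hπ E` a `G`-monoid (`rayAction`) satisfying `hadd`/`hgal`/`hsock`; g10 (`…EllipticUnitsLocalTower/Relation`)
put the elliptic units `e(𝔠)` into `𝒰_𝔓` with the relation `hrel`.  THIS file performs the ONE-`𝔓` ASSEMBLY:

* §1 `hcomm_rayAdicTower` (all commutators of `G` lie in every level — `K(𝔪v^{n+1})/K` abelian), `norm_coeff_relSeries_le_one`
  (the uniform bound `C = 1` for the `Θ`-read log-free series of the relative units);
* §2 ★★★ `exists_groupDistribution_twisting_eq_induce_ellipticUnitsLocal` — **for the family of elliptic units `e(𝔠) ∈ 𝒰_𝔓`, `𝔠 ∈ I`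
  (ideals prime to `𝔪v` with Galois lifts `g_𝔠 ∈ Gal(K̄/K(𝔪))` of their Artin symbols), and two auxiliary indices `𝔞₁, 𝔞₂ ∈ I` carrying
  the division data (VERBATIM the hypotheses of the package along `rayAdicTower h𝔪 v`), THERE IS a bounded `ℂ₂`-valued distribution `μ`
  on `G` along `K(𝔪v^{n+1})`, `‖μ‖ = 1`, with `δ_{g_𝔠, N𝔠} μ = i(e(𝔠))` levelwise for EVERY `𝔠 ∈ I`** — `i` the measure of II.4.6 read
  from the relative Coleman log-free series through `Θ`.  All local analytic data (the absolute Lubin–Tate model `π = u·2` at `v`,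
  `θ : ℂ_{K_v} → ℂ₂`, `j : 𝒪_E → 𝐃`, `e₂ : 𝒪_v ≃ ℤ₂`, the cell maps `ψ`) stay parameters, exactly as in the package.

With `integral_character_pow_succ_of_twisting_eq_induce_seriesFamily` (p728641) the moments `∫ κ^{k+1} dμ` are then the Coleman
derivatives `[S⁰]D^k` of the elliptic units' series — the algebraic half of II.4.7–4.12; the analytic identification of those numbers
with `L`-values (II.4.9–4.10, brick B6) and the semi-local product over `𝔓 ∣ 𝔭` (B2) are NOT here.  HONEST FRAMING: an assembly of
accepted kernel theorems over published named facts; nothing here closes a crux; no summit statement is proved; BSD is not proved by any of this.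

## References
* [deShalit1987] E. de Shalit, *Iwasawa theory of elliptic curves with complex multiplication* (1987), II.4.6 (14) (p. 59), II.4.7 (16)–(17)
  (p. 60), II.4.12 (29)–(33) (p. 66–69), II.2.4 (ii) (p. 44), II.1.10 (p. 39).
-/

-- the summit namespace `Summit.BirchSwinnertonDyer.BirchSwinnertonDyer` repeats the problem name by design (D-0017)
set_option linter.dupNamespace false
set_option autoImplicit false

noncomputable section

open scoped Classical nonZeroDivisors
open scoped NumberField
open Field IsDedekindDomain IsDedekindDomain.HeightOneSpectrum ValuativeRel IsLocalRing MvPowerSeries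
open Literature.NumberTheory.NumberFields
open Literature.NumberTheory.GaloisRepresentations Literature.NumberTheory.GaloisRepresentations.IsNonarchimedeanLocalField
  Literature.NumberTheory.GaloisRepresentations.LubinTate Literature.NumberTheory.GaloisRepresentations.ArtinLocalGlobal
  Literature.NumberTheory.PAdicHodge
open Literature.NumberTheory.EllipticCurves Literature.NumberTheory.EllipticCurves.GroupDistribution
open Literature.NumberTheory.ComplexMultiplication.EllipticUnits
open Literature.NumberTheory.LFunctions.AbelianDensity (artinSymbol)

namespace Summit.BirchSwinnertonDyer.BirchSwinnertonDyer.Theorems.PrintCf2.EllipticUnitsLocal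

variable {K : Type} [Field K] [NumberField K] {𝔪 : Ideal (𝓞 K)} {v : HeightOneSpectrum (𝓞 K)}

/-! ## §1. The tower inputs: commutators; the uniform coefficient bound `C = 1` -/

section Tower

/-- **All commutators of `G = Gal(K̄/K(𝔪))` lie in every level `Gal(K̄/K(𝔪v^{n+1}))`** (`K(𝔪v^{n+1})/K` is abelian) — the `hcomm` of
`exists_twisting_μ_eq_forall_seriesFamily` for `rayAdicTower`. [cite: deShalit1987, II.4.12 (p. 67)] [cite: NeukirchANT1999, Ch. VI §6 Def. (6.2)] -/
theorem hcomm_rayAdicTower (h𝔪 : 𝔪 ≠ ⊥) (v : HeightOneSpectrum (𝓞 K)) (n : ℕ)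
    (x y : ↥(absRestrictNormalHom (rayClassField K 𝔪)).ker) :
    x * y * x⁻¹ * y⁻¹ ∈ (rayAdicTower (𝔪 := 𝔪) h𝔪 v).U n := by
  rw [mem_rayAdicTower_U_iff, Subgroup.coe_mul, Subgroup.coe_mul, Subgroup.coe_mul, Subgroup.coe_inv, Subgroup.coe_inv,
    ← commutatorElement_def]
  exact commutator_le_ker_absRestrictNormalHom_of_isAbelianGalois _
    (Subgroup.commutator_mem_commutator (Subgroup.mem_top _) (Subgroup.mem_top _))

end Tower

section Local

attribute [local instance] ltNormUniformSpace ltNormIsUniformAddGroup rk1 nF nE fintypeResidueField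
attribute [local instance] RelNormCoherentUnits.instCommMonoid

variable (hq : residueFieldCard (v.adicCompletion K) = 2)
  (h2 : (valuation (v.adicCompletion K)).IsUniformizer ((((2 : ℕ) : 𝒪[v.adicCompletion K]) : v.adicCompletion K)))
  (u : 𝒪[v.adicCompletion K]ˣ)
  (E : IntermediateField (v.adicCompletion K) (AlgebraicClosure (v.adicCompletion K)))
  [FiniteDimensional (v.adicCompletion K) E] [IsGalois (v.adicCompletion K) E] (hE : E ≤ maxUnramified (v.adicCompletion K))
  {σ₀ : absoluteGaloisGroup (v.adicCompletion K)} (hσ₀ : IsAbsArithFrob σ₀)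
  {ε : (maxUnramifiedCompletion (v.adicCompletion K))ˣ}
  (hε : maxUnramifiedCompletion.galAut (v.adicCompletion K) σ₀ (ε : maxUnramifiedCompletion (v.adicCompletion K)) =
    algebraMap 𝒪[v.adicCompletion K] (maxUnramifiedCompletion (v.adicCompletion K)) (u : 𝒪[v.adicCompletion K]) *
      (ε : maxUnramifiedCompletion (v.adicCompletion K)))
  (θ : CompletedAlgClosure (v.adicCompletion K) →+* ℂ_[2])
  (hθ1 : ∀ z : CBall (v.adicCompletion K), ‖θ (z : CompletedAlgClosure (v.adicCompletion K))‖ ≤ 1)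
  (j : unitBall E →+* UnrCoeff (v.adicCompletion K))
  (hjC : (algebraMap (UnrCoeff (v.adicCompletion K)) (CBall (v.adicCompletion K))).comp j = unitBallToCBall E)

include hjC hθ1 in
/-- **The uniform coefficient bound `C = 1`** for the `Θ`-read log-free series `Θ(j((δ_E g_β)~) ∘ ϑ)` of EVERY relative unit `β`
(integral coefficients read through `θ` of norm `≤ 1`) — the `hC` of the package. [cite: deShalit1987, I.3.3 (8) (p. 17), I.3.8 (p. 20)] -/
theorem norm_coeff_relSeries_le_one (β : RelNormCoherentUnits (isUniformizer_unit_mul h2 u) E) (k : ℕ) :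
    ‖PowerSeries.coeff k ((PowerSeries.subst (compSeriesC h2 hσ₀ u hε)
      ((relTildeSeries (isUniformizer_unit_mul h2 u) E hq hE hσ₀ (LTCoeff.of (v.adicCompletion K) (u : 𝒪[v.adicCompletion K])) β).map
        j)).map (θ.comp ((CBall (v.adicCompletion K)).subtype.comp
          (algebraMap (UnrCoeff (v.adicCompletion K)) (CBall (v.adicCompletion K))))))‖ ≤ 1 := by
  rw [map_subst_compSeriesC_map_eq h2 u E hσ₀ j hε θ hjC]
  exact norm_coeff_map_le_one θ hθ1 _ _

end Local

/-! ## §2. THE ONE-`𝔓` ASSEMBLY of de Shalit II.4.12 for the elliptic units -/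

section Assembly

attribute [local instance] ltNormUniformSpace ltNormIsUniformAddGroup rk1 nF nE fintypeResidueField
attribute [local instance] RelNormCoherentUnits.instCommMonoid

variable [NumberField.IsTotallyComplex K]
  -- the prints and the global frame
  (h24ii : DeShalit1987.prop24_ii_galoisAction) (h24iii : DeShalit1987.prop24_iii_unit) (h25 : DeShalit1987.prop25_i_normRelation)
  (hK : IsImaginaryQuadratic K) (ι : K →+* ℂ)
  (h𝔪0 : 𝔪 ≠ ⊥) (h𝔪1 : 𝔪 ≠ ⊤) (hv : ¬ 𝔪 ≤ v.asIdeal) (hw : ∀ u : (𝓞 K)ˣ, (u : 𝓞 K) - 1 ∈ 𝔪 → u = 1)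
  -- the absolute Lubin–Tate model `π = u·2` at `v` and its unramified base `E`
  (hq : residueFieldCard (v.adicCompletion K) = 2)
  (h2 : (valuation (v.adicCompletion K)).IsUniformizer ((((2 : ℕ) : 𝒪[v.adicCompletion K]) : v.adicCompletion K)))
  (u : 𝒪[v.adicCompletion K]ˣ)
  {α : 𝓞 K} (hα0 : α ≠ 0) (hα𝔪 : α - 1 ∈ 𝔪) (hαw : ∀ w : HeightOneSpectrum (𝓞 K), w ≠ v → α ∉ w.asIdeal)
  {f : ℕ} (hαπ : ((α : K) : v.adicCompletion K) =
    ((((u : 𝒪[v.adicCompletion K]) * ((2 : ℕ) : 𝒪[v.adicCompletion K]) : 𝒪[v.adicCompletion K]) : v.adicCompletion K)) ^ f)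
  (E : IntermediateField (v.adicCompletion K) (AlgebraicClosure (v.adicCompletion K)))
  [FiniteDimensional (v.adicCompletion K) E] [IsGalois (v.adicCompletion K) E] (hE : E ≤ maxUnramified (v.adicCompletion K))
  (hdegE : ∀ w : WeilGroup (v.adicCompletion K),
    WeilGroup.toAbsGalois (v.adicCompletion K) w ∈ E.fixingSubgroup → (f : ℤ) ∣ WeilGroup.deg w)
  -- the local analytic data: arithmetic Frobenius, the unit `ε`, the reading `θ : ℂ_{K_v} → ℂ₂`, `j : 𝒪_E → 𝐃`, `e₂ : 𝒪_v ≃ ℤ₂`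
  {σ₀ : absoluteGaloisGroup (v.adicCompletion K)} (hσ₀ : IsAbsArithFrob σ₀)
  {ε : (maxUnramifiedCompletion (v.adicCompletion K))ˣ}
  (hε : maxUnramifiedCompletion.galAut (v.adicCompletion K) σ₀ (ε : maxUnramifiedCompletion (v.adicCompletion K)) =
    algebraMap 𝒪[v.adicCompletion K] (maxUnramifiedCompletion (v.adicCompletion K)) (u : 𝒪[v.adicCompletion K]) *
      (ε : maxUnramifiedCompletion (v.adicCompletion K)))
  (θ : CompletedAlgClosure (v.adicCompletion K) →+* ℂ_[2])
  (hθ1 : ∀ z : CBall (v.adicCompletion K), ‖θ (z : CompletedAlgClosure (v.adicCompletion K))‖ ≤ 1)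
  (j : unitBall E →+* UnrCoeff (v.adicCompletion K))
  (hj : j.comp (algebraMap (LTCoeff (v.adicCompletion K)) (unitBall E)) =
    (intToUnrCoeff (v.adicCompletion K)).comp (LTCoeff.of (v.adicCompletion K)).symm.toRingHom)
  (hjC : (algebraMap (UnrCoeff (v.adicCompletion K)) (CBall (v.adicCompletion K))).comp j = unitBallToCBall E)
  (e₂ : v.adicCompletionIntegers K ≃+* ℤ_[2])
  (hΘe : ∀ a : 𝒪[v.adicCompletion K], (θ.comp ((CBall (v.adicCompletion K)).subtype.comp
      (algebraMap (UnrCoeff (v.adicCompletion K)) (CBall (v.adicCompletion K))))) (intToUnrCoeff (v.adicCompletion K) a) =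
    padicIntCast ℂ_[2] (((e₂ : v.adicCompletionIntegers K →+* ℤ_[2]).comp
      (integerEquivAdicCompletionIntegers v).toRingHom) a))
  -- the cell maps of the tower `K(𝔪v^{n+1})` for `κ := κ_v⁻¹` read in `ℤ₂`
  (ψ : (n : ℕ) → ↥(absRestrictNormalHom (rayClassField K 𝔪)).ker ⧸ (rayAdicTower (𝔪 := 𝔪) h𝔪0 v).U n → ZMod (2 ^ (n + 1)))
  (hψ : ∀ (n : ℕ) (g : ↥(absRestrictNormalHom (rayClassField K 𝔪)).ker), g ∈ (rayAdicTower (𝔪 := 𝔪) h𝔪0 v).U 0 →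
    ψ n ((rayAdicTower (𝔪 := 𝔪) h𝔪0 v).proj n g) =
      PadicInt.toZModPow (n + 1) ((((Units.map (e₂ : v.adicCompletionIntegers K →+* ℤ_[2]).toMonoidHom).comp
        (rayAdicCharacter h𝔪0 hv hw))⁻¹ g : ℤ_[2]ˣ) : ℤ_[2]))
  -- the twists: ideals `𝔠` prime to `𝔪v`, Galois lifts `g_𝔠 ∈ Gal(K̄/K(𝔪))` of their Artin symbols, elliptic-unit families under `Θ(1; 𝔪v^{m+1}, 𝔠)`
  {I : Type*} (idl : I → Ideal (𝓞 K)) (hidl0 : ∀ i, idl i ≠ ⊥) (hidlc : ∀ i, IsCoprime (idl i) (𝔪 * v.asIdeal))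
  (g : I → ↥(absRestrictNormalHom (rayClassField K 𝔪)).ker)
  (hg : ∀ (i : I) (m : ℕ), absRestrictNormalHom (rayClassField K (𝔪 * v.asIdeal ^ (m + 1))) (g i : absoluteGaloisGroup K) =
    artinSymbol (galFrob K (rayClassField K (𝔪 * v.asIdeal ^ (m + 1)))) (idl i))
  (x : ∀ (i : I) (m : ℕ), rayClassField K (𝔪 * v.asIdeal ^ (m + 1)))
  (hx : ∀ (i : I) (m : ℕ), IsThetaValueOne ι (𝔪 * v.asIdeal ^ (m + 1)) (idl i)
    (algClosureEmb ι ((x i m : rayClassField K (𝔪 * v.asIdeal ^ (m + 1))) : AlgebraicClosure K)))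

set_option maxHeartbeats 800000 in
include h24ii hq hj hjC hΘe hg in
/-- ★★★ **de Shalit II.4.12 at one `𝔓`-component for the elliptic units — the measure `μ_𝔓(𝔪)` EXISTS.**  In the setting above
(`K` imaginary quadratic, `𝔪 ≠ 0, 𝒪_K`, `v ∤ 𝔪`, `w_𝔪 = 1`; the absolute Lubin–Tate model `π = u·2`, `α = π^f`, `(α) = 𝔭_v^f`, `α ≡ 1 mod 𝔪`;
an unramified Galois base `E` with `f ∣ deg w` on `Gal(K̄_v/E)`; the local analytic data `σ₀, ε, θ, j, e₂`; cell maps `ψ` for `κ_v⁻¹`;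
twists `𝔠 ∈ I` with lifts `g_𝔠` and elliptic-unit families `x^𝔠` under `Θ(1; 𝔪v^{m+1}, 𝔠)`), GIVEN de Shalit II.2.4 (ii)/(iii) and II.2.5 (i)
as named facts, and two indices `𝔞₁, 𝔞₂ ∈ I` carrying the division data of the package VERBATIM along `rayAdicTower h𝔪 v`
(`g_{𝔞ᵢ} ∈ U_s`, `g_{𝔞₁}` generates `U_s/U_m` for all `m`, `2`-power orders, unbounded; `N𝔞₁ = N𝔞₂ ≥ 2`, `4 ∣ N𝔞₁ − 1`;
`g_{𝔞₂}^k g_{𝔞₁}^{-k} ∉ ⋂ U_n` — cf2c-w4 g8's `hgen_artin`/`hpow_artin`/`hunb_artin`/`hτ_artin` for `𝔞ᵢ = (αᵢ)`):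
**there is a bounded distribution `μ` on `Gal(K̄/K(𝔪))` along `K(𝔪v^{n+1})`, `‖μ‖ = 1`, with
`δ_{g_𝔠, N𝔠} μ = i(e(𝔠))` levelwise for every `𝔠 ∈ I`**, where `e(𝔠) = ellipticUnitsLocal … (x 𝔠) ∈ 𝒰_𝔓` and `i` is the measure of
II.4.6 of the relative Coleman log-free series read through `Θ = θ ∘ (𝐃 → ℂ_{K_v})`.
[cite: deShalit1987, II.4.12 (p. 66–69), II.4.6 (14) (p. 59), II.2.4 (ii) (p. 44), II.1.10 Corollary (p. 39)] -/
theorem exists_groupDistribution_twisting_eq_induce_ellipticUnitsLocal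
    [hN : ∀ n, ((rayAdicTower (𝔪 := 𝔪) h𝔪0 v).U n).Normal]
    {s : ℕ} (a₁ a₂ : I) (hσ₁ : g a₁ ∈ (rayAdicTower (𝔪 := 𝔪) h𝔪0 v).U s) (hσ₂ : g a₂ ∈ (rayAdicTower (𝔪 := 𝔪) h𝔪0 v).U s)
    (hgen : ∀ m, s ≤ m → ∀ w ∈ (rayAdicTower (𝔪 := 𝔪) h𝔪0 v).U s, ∃ k : ℕ,
      (rayAdicTower (𝔪 := 𝔪) h𝔪0 v).proj m (g a₁ ^ k) = (rayAdicTower (𝔪 := 𝔪) h𝔪0 v).proj m w)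
    (hpow : ∀ n, s ≤ n → ∃ r : ℕ, orderOf ((rayAdicTower (𝔪 := 𝔪) h𝔪0 v).proj n (g a₁)) = 2 ^ r)
    (hunb : ∀ r : ℕ, ∃ m, 2 ^ r ∣ orderOf ((rayAdicTower (𝔪 := 𝔪) h𝔪0 v).proj m (g a₁)))
    (hN1 : 2 ≤ Ideal.absNorm (idl a₁)) (h4 : 4 ∣ Ideal.absNorm (idl a₁) - 1) (hN12 : Ideal.absNorm (idl a₂) = Ideal.absNorm (idl a₁))
    (hτ : ∀ k, 0 < k → ∃ n, s ≤ n ∧ g a₂ ^ k * (g a₁ ^ k)⁻¹ ∉ (rayAdicTower (𝔪 := 𝔪) h𝔪0 v).U n) :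
    letI := rayAction h𝔪0 hv hw (isUniformizer_unit_mul h2 u) E hE
    ∃ μ : GroupDistribution (rayAdicTower (𝔪 := 𝔪) h𝔪0 v) ℂ_[2], μ.bound = 1 ∧
      ∀ (c : I) (n : ℕ) (b : ↥(absRestrictNormalHom (rayClassField K 𝔪)).ker ⧸ (rayAdicTower (𝔪 := 𝔪) h𝔪0 v).U n),
        (twisting (g c) (Ideal.absNorm (idl c) : ℂ_[2]) μ).μ n b =
        (GroupDistribution.induce
          (fun β : RelNormCoherentUnits (isUniformizer_unit_mul h2 u) E ↦
            (GroupDistribution.comap (restrictUnits ((invAmice₁ 2 ((PowerSeries.subst (compSeriesC h2 hσ₀ u hε)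
              ((relTildeSeries (isUniformizer_unit_mul h2 u) E hq hE hσ₀
                (LTCoeff.of (v.adicCompletion K) (u : 𝒪[v.adicCompletion K])) β).map j)).map
              (θ.comp ((CBall (v.adicCompletion K)).subtype.comp
                (algebraMap (UnrCoeff (v.adicCompletion K)) (CBall (v.adicCompletion K))))))
              (norm_coeff_relSeries_le_one hq h2 u E hE hσ₀ hε θ hθ1 j hjC β)).density
              (ProfiniteTower.padicInt_isUniform 2) (unitInv ℂ_[2]) uniformContinuous_unitInv norm_unitInv_le))
              ψ ((rayAdicTower (𝔪 := 𝔪) h𝔪0 v).cellMap_trans (((Units.map (e₂ : v.adicCompletionIntegers K →+* ℤ_[2]).toMonoidHom).comp (rayAdicCharacter h𝔪0 hv hw))⁻¹) ψ hψ)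
              ((rayAdicTower (𝔪 := 𝔪) h𝔪0 v).cellMap_injective (((Units.map (e₂ : v.adicCompletionIntegers K →+* ℤ_[2]).toMonoidHom).comp (rayAdicCharacter h𝔪0 hv hw))⁻¹)
                (mem_rayAdicTower_iff_inv h𝔪0 h𝔪0 hv hw e₂ le_rfl hv) ψ hψ)
              ((rayAdicTower (𝔪 := 𝔪) h𝔪0 v).cellMap_fiberSurj (((Units.map (e₂ : v.adicCompletionIntegers K →+* ℤ_[2]).toMonoidHom).comp (rayAdicCharacter h𝔪0 hv hw))⁻¹)
                (mem_rayAdicTower_iff_inv h𝔪0 h𝔪0 hv hw e₂ le_rfl hv)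
                (exists_toZModPow_padicRayAdicCharacter_inv_eq h𝔪0 h𝔪0 hv hw e₂ le_rfl hv) ψ hψ)))
          zero_le_one (fun _ ↦ le_rfl)
          (ellipticUnitsLocal h24iii h25 hK ι h𝔪0 h𝔪1 hv hw (isUniformizer_unit_mul h2 u) hα0 hα𝔪 hαw hαπ E hE hdegE
            (hidl0 c) (hidlc c) (x c) (hx c))).μ n b := by
  letI := rayAction h𝔪0 hv hw (isUniformizer_unit_mul h2 u) E hE
  have h := exists_twisting_μ_eq_forall_seriesFamily (hq := hq) (h2 := h2) (hσ₀ := hσ₀) (u := u) (hε := hε)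
    (Θ := θ.comp ((CBall (v.adicCompletion K)).subtype.comp
      (algebraMap (UnrCoeff (v.adicCompletion K)) (CBall (v.adicCompletion K)))))
    (e := (e₂ : v.adicCompletionIntegers K →+* ℤ_[2]).comp (integerEquivAdicCompletionIntegers v).toRingHom) (hΘe := hΘe)
    (κ := ((Units.map (e₂ : v.adicCompletionIntegers K →+* ℤ_[2]).toMonoidHom).comp (rayAdicCharacter h𝔪0 hv hw))⁻¹)
    (hU := mem_rayAdicTower_iff_inv h𝔪0 h𝔪0 hv hw e₂ le_rfl hv)
    (hκ := exists_toZModPow_padicRayAdicCharacter_inv_eq h𝔪0 h𝔪0 hv hw e₂ le_rfl hv) (ψ := ψ) (hψ := hψ)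
    (φ := fun β : RelNormCoherentUnits (isUniformizer_unit_mul h2 u) E ↦
      (relTildeSeries (isUniformizer_unit_mul h2 u) E hq hE hσ₀ (LTCoeff.of (v.adicCompletion K) (u : 𝒪[v.adicCompletion K])) β).map j)
    (hadd := seriesFamily_hadd_rayUnits (h2 := h2) (u := u) (E := E) (hq := hq) (hE := hE) (hσ₀ := hσ₀)
      (uL := LTCoeff.of (v.adicCompletion K) (u : 𝒪[v.adicCompletion K])) (j := j))
    (hgal := seriesFamily_hgal_rayAction (h𝔪 := h𝔪0) (hv := hv) (hw := hw) (h2 := h2) (u := u) (E := E) (hE := hE) (hq := hq)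
      (hσ₀ := hσ₀) (uL := LTCoeff.of (v.adicCompletion K) (u : 𝒪[v.adicCompletion K])) (j := j) (hj := hj)
      (e := (e₂ : v.adicCompletionIntegers K →+* ℤ_[2]).comp (integerEquivAdicCompletionIntegers v).toRingHom)
      (𝒰 := rayAdicTower (𝔪 := 𝔪) h𝔪0 v)
      (κ := (((Units.map (e₂ : v.adicCompletionIntegers K →+* ℤ_[2]).toMonoidHom).comp (rayAdicCharacter h𝔪0 hv hw))⁻¹))
      (hκ := padicRayAdicCharacter_inv_apply h𝔪0 hv hw e₂))
    (hC := norm_coeff_relSeries_le_one hq h2 u E hE hσ₀ hε θ hθ1 j hjC)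
    (hC0 := zero_le_one) (hCb := fun _ ↦ le_rfl) (hcomm := hcomm_rayAdicTower h𝔪0 v)
    (β := fun c ↦ ellipticUnitsLocal h24iii h25 hK ι h𝔪0 h𝔪1 hv hw (isUniformizer_unit_mul h2 u) hα0 hα𝔪 hαw hαπ E hE hdegE
      (hidl0 c) (hidlc c) (x c) (hx c))
    (σ := g) (Nm := fun c ↦ Ideal.absNorm (idl c))
    (hrel := fun a c ↦ hrel_ellipticUnitsLocal h24ii h24iii h25 hK ι h𝔪0 h𝔪1 hv hw (isUniformizer_unit_mul h2 u) hα0 hα𝔪 hαw hαπ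
      E hE hdegE (hidl0 a) (hidlc a) (hidl0 c) (hidlc c) (x a) (hx a) (x c) (hx c) (g a) (g c) (hg a) (hg c))
    a₁ a₂ hσ₁ hσ₂ hgen hpow hunb hN1 h4 hN12 hτ
  exact h

end Assembly

end Summit.BirchSwinnertonDyer.BirchSwinnertonDyer.Theorems.PrintCf2.EllipticUnitsLocal

end
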